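import Summits.CriticalPhenomena.CardyFormulaZ2.Theorems.CardyAnchoredRigiditySubseqCardyKernelFacts
import Summits.CriticalPhenomena.CardyFormulaZ2.Theorems.CardyUniqueLimitCardyRigidityStubKernelAffineCardy
import Summits.CriticalPhenomena.CardyFormulaZ2.Theses.CardyMirrorMonotone

/-!
# Sequential crossing kernels, IV: identification with Cardy's `F` from the crossing-martingale
# property ALONG A SEQUENCE — the martingale route to S3 / stmt-8271 has all its analysis done
# (crux `SubseqCardy`, stmt-CriticalPhenomena-5768, line `registered`, lead c5: kernel facts, part 4)

Route `CardyAnchoredRigidity` (decl shared with `CardyLocalRigidity`), sub-problem `CardyFormulaZ2`.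
The line's stub S3 `stub_conformalLimitIsCardy` is EQUIVALENT to the open identification item
stmt-8271 `CardyMirrorMonotone.SubseqRigidity` ("a SEQUENTIAL crossing kernel `f` — `u n → 0⁺`,
`bondDomainCrossingProb R (u n) → f (crossRatio x)` for every conformal rectangle and every
uniformizing datum — is Cardy's `F` on `(0,1)`"; twins stmt-4680, stmt-8850). Its registered line is
the Camia–Newman / SLE programme. The full-filter sibling crux `CardyRigidity` (stmt-0746) has a SECOND
registered line, `crossing_martingale`: a regular driving process whose level-stopped one-sided
crossing observables with kernel `f` are martingales forces `f = A·I_{2/3} + B` (the LANDED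
`stub_kernelAffineCardy`, p152942), and the kernel facts (continuity, boundary values; landed
`stub_kernelFacts` for the full filter) pin `A = 1`, `B = 0`, `I_{2/3} = F`.

With the SEQUENTIAL kernel facts of parts 1–3 (`seqKernelFacts`, this line) the same identification
runs ALONG A SEQUENCE OF MESHES:

* `Kernel.eqOn_cardyFunction_of_crossingMartingale` — **if a sequential crossing kernel `f` admits a
  regular driving process with the `f`-crossing-martingale property (on any probability space), then
  `f = F` on `(0,1)`** (`seqKernelFacts` + `stub_kernelAffineCardy` + the boundary values of
  `I_{2/3}` + `cardyFunction_eq_incBeta13_div`);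
* `subseqRigidity_of_seqCrossingMartingale` — hence the crux `SubseqRigidity` (stmt-8271), and with it
  S3, follow from the SEQUENTIAL twin of STUB A of line `crossing_martingale`: "for every sequential
  crossing kernel `(u, f)` some subsequential interface limit along `u` carries a regular driver with
  the `f`-crossing-martingale property" (stated inline as a hypothesis, no new definition) — the only
  percolation-side input still open on that route, now identified as sufficient along sequences too;
* `subseqCardy_of_subseqConformalInvariance_of_seqCrossingMartingale` — the crux `SubseqCardy` from
  X_M (stmt-8266) and that sequential martingale input.

References: W. Werner, *Lectures on two-dimensional critical percolation* (2007) §3; J. Cardy, J. Phys.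
A 25 (1992) L201, eq. (8); A. Kemppainen, S. Smirnov, Ann. Probab. 45 (2017) Thm 1.3.
-/

noncomputable section

namespace Summit.CriticalPhenomena.CardyFormulaZ2.Cruxes.SubseqCardy.Birth

open Set Filter Topology MeasureTheory
open scoped NNReal
open Literature.Probability.RandomPlanarGeometry
open Literature.Probability.Percolation (bondDomainCrossingProb)
open Summit.CriticalPhenomena.CardyFormulaZ2.Cruxes.CardyRigidity.CrossingMartingale (betaLaw
  IsRegularDriver IsCrossingMartingaleFamily stub_kernelAffineCardy betaLaw_two_thirds
  tendsto_betaLaw_two_thirds_zero tendsto_betaLaw_two_thirds_one)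
open Summit.CriticalPhenomena.CardyFormulaZ2.Theses

namespace Kernel

variable {u : ℕ → ℝ} {f : ℝ → ℝ}

/-- **A sequential crossing kernel with the crossing-martingale property is Cardy's function.** If
`u n → 0⁺`, `bondDomainCrossingProb R (u n) → f (crossRatio x)` for every conformal rectangle and every
uniformizing datum, and on some probability space a regular driving process has all its level-stopped
one-sided crossing observables with kernel `f` martingales, then `f = F` on `(0,1)`: the landed
`stub_kernelAffineCardy` gives `f = A·I_{2/3} + B` (continuity of `f`: `seqKernelFacts`), and the
boundary values `f(0⁺) = 0`, `f(1⁻) = 1` (`seqKernelFacts`) force `B = 0`, `A = 1`.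
[cite: Werner2007, §3] -/
theorem eqOn_cardyFunction_of_crossingMartingale (hu : Tendsto u atTop (𝓝[>] (0 : ℝ)))
    (hf : ∀ (R : ConformalRectangle) (φ : ConformalEquiv UpperHalfPlane.upperHalfPlaneSet R.carrier)
      (x : Fin 4 → ℝ), R.IsUniformizing φ x →
      Tendsto (fun n => bondDomainCrossingProb R (u n)) atTop (𝓝 (f (crossRatio x))))
    {Ω : Type} [MeasurableSpace Ω] (μ : Measure Ω) [IsProbabilityMeasure μ]
    (W : Ω → ℝ≥0 → ℝ) (𝓕 : Filtration ℝ≥0 ‹MeasurableSpace Ω›)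
    (hreg : IsRegularDriver μ W 𝓕) (hmart : IsCrossingMartingaleFamily f μ W 𝓕) :
    EqOn f Literature.Probability.RandomPlanarGeometry.cardyFunction (Ioo 0 1) := by
  obtain ⟨hcont, hf0, hf1⟩ := seqKernelFacts u hu f hf
  obtain ⟨A, B, hfab⟩ := stub_kernelAffineCardy f hcont Ω μ W 𝓕 hreg hmart
  -- the boundary values of `f` along the affine form: `B = 0`, `A = 1`
  have hev0 : ∀ᶠ η in 𝓝[>] (0 : ℝ), f η = A * betaLaw (2 / 3) η + B :=
    Filter.eventually_of_mem (Ioo_mem_nhdsGT zero_lt_one) fun η hη ↦ hfab hη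
  have hev1 : ∀ᶠ η in 𝓝[<] (1 : ℝ), f η = A * betaLaw (2 / 3) η + B :=
    Filter.eventually_of_mem (Ioo_mem_nhdsLT zero_lt_one) fun η hη ↦ hfab hη
  have hlim0 : Tendsto f (𝓝[>] 0) (𝓝 (A * 0 + B)) :=
    ((tendsto_betaLaw_two_thirds_zero.const_mul A).add_const B).congr' (hev0.mono fun η hη ↦ hη.symm)
  have hlim1 : Tendsto f (𝓝[<] 1) (𝓝 (A * 1 + B)) :=
    ((tendsto_betaLaw_two_thirds_one.const_mul A).add_const B).congr' (hev1.mono fun η hη ↦ hη.symm)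
  have hB0 : B = 0 := by
    have := tendsto_nhds_unique hlim0 hf0
    simpa using this
  have hA1 : A = 1 := by
    have := tendsto_nhds_unique hlim1 hf1
    rw [hB0] at this
    simpa using this
  intro η hη
  have hfη : f η = A * betaLaw (2 / 3) η + B := hfab hη
  rw [hfη, hA1, hB0, one_mul, add_zero, betaLaw_two_thirds]
  exact (cardyFunction_eq_incBeta13_div_holds η (Ioo_subset_Icc_self hη)).symm

end Kernel

/-- **Sub-goal `subseqRigidity_of_seqCrossingMartingale` (line `registered`, lead c5; kernel facts,
part 4) — sequential Cardy rigidity (stmt-8271, ⟺ S3) from the SEQUENTIAL crossing-martingale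
input.** If for every sequential crossing kernel `(u, f)` of bond-`ℤ²` percolation some probability
space carries a regular driving process with the `f`-crossing-martingale property (the sequential twin
of STUB A of line `crossing_martingale` of crux `CardyRigidity`, stmt-0746: tightness + Kemppainen–Smirnov
regularity + passage of the discrete crossing martingale to the limit, run along `u`), then
`CardyMirrorMonotone.SubseqRigidity` holds. [cite: Werner2007, §3] -/
theorem subseqRigidity_of_seqCrossingMartingale : (∀ u : ℕ → ℝ, Filter.Tendsto u Filter.atTop (nhdsWithin (0 : ℝ) (Set.Ioi 0)) → ∀ f : ℝ → ℝ, (∀ (R : Literature.Probability.RandomPlanarGeometry.ConformalRectangle) (φ : Literature.Probability.RandomPlanarGeometry.ConformalEquiv UpperHalfPlane.upperHalfPlaneSet R.carrier) (x : Fin 4 → ℝ), R.IsUniformizing φ x → Filter.Tendsto (fun n => Literature.Probability.Percolation.bondDomainCrossingProb R (u n)) Filter.atTop (nhds (f (Literature.Probability.RandomPlanarGeometry.crossRatio x)))) → ∃ (Ω : Type) (_ : MeasurableSpace Ω) (μ : MeasureTheory.Measure Ω) (_ : MeasureTheory.IsProbabilityMeasure μ) (W : Ω → NNReal → ℝ)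 (𝓕 : MeasureTheory.Filtration NNReal ‹MeasurableSpace Ω›), Summit.CriticalPhenomena.CardyFormulaZ2.Cruxes.CardyRigidity.CrossingMartingale.IsRegularDriver μ W 𝓕 ∧ Summit.CriticalPhenomena.CardyFormulaZ2.Cruxes.CardyRigidity.CrossingMartingale.IsCrossingMartingaleFamily f μ W 𝓕) → Summit.CriticalPhenomena.CardyFormulaZ2.Theses.CardyMirrorMonotone.SubseqRigidity := by
  intro hA u hu f hf
  obtain ⟨Ω, _, μ, _, W, 𝓕, hreg, hmart⟩ := hA u hu f hf
  exact Kernel.eqOn_cardyFunction_of_crossingMartingale hu hf μ W 𝓕 hreg hmart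

/-- **The crux `SubseqCardy` from X_M (stmt-8266) and the sequential crossing-martingale input**
(`subseqCardy_of_items` with sequential rigidity supplied by `subseqRigidity_of_seqCrossingMartingale`).
[cite: Werner2007, §3] -/
theorem subseqCardy_of_subseqConformalInvariance_of_seqCrossingMartingale
    (hXM : CardyMirrorMonotone.SubseqConformalInvariance)
    (hA : ∀ u : ℕ → ℝ, Filter.Tendsto u Filter.atTop (nhdsWithin (0 : ℝ) (Set.Ioi 0)) → ∀ f : ℝ → ℝ, (∀ (R : Literature.Probability.RandomPlanarGeometry.ConformalRectangle) (φ : Literature.Probability.RandomPlanarGeometry.ConformalEquiv UpperHalfPlane.upperHalfPlaneSet R.carrier) (x : Fin 4 → ℝ), R.IsUniformizing φ x → Filter.Tendsto (fun n => Literature.Probability.Percolation.bondDomainCrossingProb R (u n)) Filter.atTop (nhds (f (Literature.Probability.RandomPlanarGeometry.crossRatio x)))) → ∃ (Ω : Type) (_ : MeasurableSpace Ω) (μ : MeasureTheory.Measure Ω) (_ : MeasureTheory.IsProbabilityMeasure μ) (W : Ω → NNReal → ℝ) (𝓕 : MeasureTheory.Filtration NNReal ‹MeasurableSpace Ω›),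 Summit.CriticalPhenomena.CardyFormulaZ2.Cruxes.CardyRigidity.CrossingMartingale.IsRegularDriver μ W 𝓕 ∧ Summit.CriticalPhenomena.CardyFormulaZ2.Cruxes.CardyRigidity.CrossingMartingale.IsCrossingMartingaleFamily f μ W 𝓕) :
    Summit.CriticalPhenomena.CardyFormulaZ2.Theses.CardyAnchoredRigidity.SubseqCardy :=
  subseqCardy_of_items hXM (subseqRigidity_of_seqCrossingMartingale hA)

end Summit.CriticalPhenomena.CardyFormulaZ2.Cruxes.SubseqCardy.Birth

end
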